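import Mathlib
import HarnessLib
import Summits.Ventures.LatticeQCDFlow.Exactness.U1WilsonFlowLOMemberFTHMCN
import Summits.Ventures.LatticeQCDFlow.Exactness.U1LeapfrogHMCWilson
import Summits.Ventures.LatticeQCDFlow.Exactness.WilsonFlowMasks
import Literature.MathematicalPhysics.QuantumLattice.GaugeGroups

/-!
# Non-vacuity on the STEP-0 `U(1)` configuration at every `nstep`: FT-HMC through the LO member (2-d torus, parity masks, sweep schedule) converges to the `U(1)` Wilson measure from every start

HONEST FRAMING: exact (Metropolis-corrected) sampling algorithms for lattice gauge theory;
figures of merit are autocorrelation/cost numbers at stated couplings and volumes; no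
continuum-physics claim.

Venture `LatticeQCDFlow` (cell pub-lqcd), topic `Exactness`, FANOUT row 14 (`eng-flowhmc`, `U(1)` rung
= the STEP-0 configuration of rows 3 / 4: 2-d `U(1)` on `L × L`, `L` even; member
`maps.u1_wilson_flow_lo` with parity masks and the sweep schedule `(0, even), (0, odd), (1, even),
(1, odd)` per sweep; the engine's chains of record ran with MULTI-STEP trajectories).  NEW WORK of the
cell over this generation's `U1WilsonFlowLOMemberFTHMCN.lean` (multi-step FT-HMC through the whole LO
member, any schedule, on row 9's kernel `u1LeapfrogHMCN`), GEN-7's `WilsonFlowMasks.lean`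
(`exists_parityMask`) and row 9's `U1LeapfrogHMCWilson.lean` (`u1GibbsLaw_eq_wilsonMeasure`,
`exists_bound_smul_wilsonAction_circle`); nothing is cited as a fact; no number.  The multi-step twin
of GEN-11's `U1StepZeroLattice`.

* **`u1_fthmcN_stepZeroLattice_wilson_uniformlyErgodic`** — for every even `L`, `2|ε| < 1`, `nsweeps`,
  `β`, there is a parity colouring `χ` of the 2-d torus and a list of `4·nsweeps` certified layers whose
  maps / densities ARE the masked `U(1)` Wilson-flow sub-steps / booked Jacobians of the schedule
  (formulas VERBATIM as in `exists_layers_u1WilsonFlowLO`) such that, with `S = β·S_W` (defining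
  representation `u1Rep`) and ANY measurable `K`-Lipschitz momentum increment bounded by `b ≥ 0` with
  `4Kε'n² ≤ 3` (`ε' > 0` the step of the `n ≥ 1` leapfrog steps, `κ' > 0`): the multi-step FT-HMC
  chain reported through the member satisfies `|μ₀K̃ᵗ(A) − μ_{Λ,β}(A)| ≤ (1 − δ)ᵗ` for some
  `δ ∈ (0, 1]`, EVERY initial law `μ₀`, every `t`, every `A` — `μ_{Λ,β} = wilsonMeasure u1Rep β`, the
  Literature's torus `U(1)` Wilson measure.  Nothing left to assume but `L` even, `2|ε| < 1` and the
  short-trajectory bound on the increment.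

NOT CLAIMED: the Lipschitz constant of the engine's autodiff increment through the member (`K` is a
hypothesis); longer trajectories; `τ_int` / acceptance numbers of the STEP-0 runs; floating point;
any number.
-/

noncomputable section

namespace Summit.Ventures.LatticeQCDFlow.Exactness

open Set MeasureTheory
open ProbabilityTheory ProbabilityTheory.Kernel
open Literature.MathematicalPhysics.QuantumFieldTheory Literature.MathematicalPhysics.QuantumLattice
open scoped ENNReal NNReal

/-- **STEP-0 `U(1)` configuration (2-d, `L` even, parity masks, sweep schedule, `2|ε| < 1`,
`S = β·S_W`) AT EVERY `nstep`: multi-step FT-HMC through the LO member converges to the `U(1)`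
Wilson measure from every start** (see the module docstring). -/
theorem u1_fthmcN_stepZeroLattice_wilson_uniformlyErgodic {L : ℕ} [NeZero L] (hL : Even L) {ε : ℝ}
    (hε : |ε| * 2 < 1) (nsweeps : ℕ) (β : ℝ) {ε' κ' : ℝ} (hε' : 0 < ε') (hκ' : 0 < κ') {n : ℕ}
    (hn : 1 ≤ n) {g : GaugeConfig 2 L Circle → Edge 2 L → ℝ} (hg : Measurable g) {K : ℝ≥0}
    (hgK : LipschitzWith K g) (hshort : 4 * (K : ℝ) * ε' * (n : ℝ) ^ 2 ≤ 3) {b' : ℝ} (hb0 : 0 ≤ b')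
    (hb : ∀ u l, ‖g u l‖ ≤ b') :
    ∃ χ : Site 2 L → ZMod 2, (∀ (x : Site 2 L) (i : Fin 2), χ (x.shift i) ≠ χ x) ∧
    ∃ layers : List ((GaugeConfig 2 L Circle ≃ᵐ GaugeConfig 2 L Circle) × (GaugeConfig 2 L Circle → ℝ)),
      layers.map (fun Ly => ((Ly.1 : GaugeConfig 2 L Circle → GaugeConfig 2 L Circle), Ly.2)) =
        ((List.replicate nsweeps ((List.finRange 2).flatMap fun μ : Fin 2 =>
          [(μ, (0 : ZMod 2)), (μ, 1)])).flatten).map (fun s =>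
        ((fun (V : GaugeConfig 2 L Circle) (e : Edge 2 L) => if e.2 = s.1 ∧ χ e.1 = s.2 then
          V e * Circle.exp (ε * ∑ ν ∈ Finset.univ.erase e.2,
            (((plaquetteHolonomy V (e.1 - Pi.single ν 1) e.2 ν : Circle) : ℂ).im -
              ((plaquetteHolonomy V e.1 e.2 ν : Circle) : ℂ).im)) else V e),
         fun V : GaugeConfig 2 L Circle => ∏ a : {e : Edge 2 L // e.2 = s.1 ∧ χ e.1 = s.2},
          (1 - ε * ∑ ν ∈ Finset.univ.erase a.1.2,
            (((plaquetteHolonomy V a.1.1 a.1.2 ν : Circle) : ℂ).re +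
              ((plaquetteHolonomy V (a.1.1 - Pi.single ν 1) a.1.2 ν : Circle) : ℂ).re)))) ∧
      layers.length = 4 * nsweeps ∧
      ∃ δ : ℝ, 0 < δ ∧ δ ≤ 1 ∧ ∀ (μ₀ : Measure (GaugeConfig 2 L Circle)) [IsProbabilityMeasure μ₀]
        (t : ℕ) (A : Set (GaugeConfig 2 L Circle)),
        |((fun m : Measure (GaugeConfig 2 L Circle) =>
              m.bind (conjKernel (u1LeapfrogHMCN ε' κ' hg (fun V =>
                  β * wilsonAction u1Rep ((layers.foldr
                    (fun Ly (F : GaugeConfig 2 L Circle ≃ᵐ GaugeConfig 2 L Circle) => Ly.1.trans F)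
                    (MeasurableEquiv.refl (GaugeConfig 2 L Circle))) V) -
                    Real.log ((layers.foldr (fun Ly K => fun v => Ly.2 v * K (Ly.1 v))
                      (fun _ => (1 : ℝ))) V)) n)
                (layers.foldr (fun Ly (F : GaugeConfig 2 L Circle ≃ᵐ GaugeConfig 2 L Circle) =>
                  Ly.1.trans F) (MeasurableEquiv.refl (GaugeConfig 2 L Circle)))))^[t] μ₀).real A
            - (wilsonMeasure (d := 2) (L := L) u1Rep β).real A| ≤ (1 - δ) ^ t := by
  obtain ⟨χ, hχ⟩ := exists_parityMask (d := 2) (L := L) hL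
  refine ⟨χ, hχ, ?_⟩
  have hε2 : |ε| * (2 * ((2 - 1 : ℕ) : ℝ)) < 1 := by norm_num; linarith
  obtain ⟨s, hs⟩ := exists_bound_smul_wilsonAction_circle (d := 2) (L := L) u1Rep continuous_u1Rep β
  obtain ⟨layers, hmap, δ, hδ0, hδ1, hbound⟩ :=
    u1WilsonFlowLO_member_fthmcN_uniformlyErgodic χ hχ hε2
      ((List.replicate nsweeps ((List.finRange 2).flatMap fun μ : Fin 2 =>
        [(μ, (0 : ZMod 2)), (μ, 1)])).flatten) hε' hκ' hn hg hgK hshort hb0 hb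
      (continuous_smul_wilsonAction u1Rep continuous_u1Rep β).measurable hs
  refine ⟨layers, hmap, ?_, δ, hδ0, hδ1, fun μ₀ _ t A => ?_⟩
  · have h := congrArg List.length hmap
    rw [List.length_map, List.length_map] at h
    rw [h]
    simp [List.length_flatten, List.length_flatMap, mul_comm]
  · rw [← u1GibbsLaw_eq_wilsonMeasure (d := 2) (L := L) u1Rep β]
    exact hbound μ₀ t A

end Summit.Ventures.LatticeQCDFlow.Exactness
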